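import Mathlib
import HarnessLib
import Summits.NavierStokesRegularity.FluidComputer.TriggeredTransferAmplifierValve

/-!
# Door N1-FC split into AMPLIFIER + VALVE: junk map and BC2 probes

Cell `ns-blowup`, seat `ns-blowup-fc-prover-1` g4 (D-0074 GROUP C «bridge support»; LADDER-NS rung N1-FC).
Companion of `TriggeredTransferAmplifierValve.lean` (the planner's typing `KickAlphabet` / `Amplifies` /
`Valve` of shape (α′) and its glue `stepGluing`). LABEL: E–C typing + kernel bookkeeping. WHAT THIS IS
NOT: not Navier–Stokes evidence — implications between OPEN predicates over the door TYPE
`TriggerScheme`; no scheme, no kicked alphabet, no transfer and no blow-up is asserted; the one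
definition (`KickAlphabet.empty`) is a junk probe.

The two pieces of the split are JOINTLY, not severally, load-bearing — recorded as theorems a
tribunal's BC2 «piece probes» can cite by name:

* `Amplifies.mono` / `Valve.anti`: the amplifier gets EASIER and the valve HARDER as the kicked alphabet
  grows — the shared alphabet is where the two pieces constrain each other;
* `KickAlphabet.empty`, `valve_empty`, `not_amplifies_empty`: with NO kicked states the valve holds
  VACUOUSLY at every viscosity while the amplifier is FALSE (the ignition level is inhabited and `ε = 1`
  is always admissible) — so `Valve` alone carries no content;
* `isTrigger_zero`, `valveClock_le`, `stepB_of_valve_of_mem`, `transfersB_of_valve_of_letters_kicked`,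
  `navierStokesBreakdownR3_of_valve_of_letters_kicked`: if the letters `F U` are themselves kicked
  states, the valve ALONE is an untriggered («quiet») bounded door `TransfersB ν` — at ANY viscosity,
  with the zero trigger, no gluing and no uniqueness — and closes (C) for `ν > 0`. The amplifier is
  needed exactly because members of `F U` are not kicked; a register whose schedules are quiet
  (unforced after preparation) is valve-only by construction (ROUTE-NOTES of the package, §3);
* `KickAlphabet.letters` (`K U := F U`, a kicked alphabet of ANY scheme by the scheme's own axioms),
  `transfersB_of_valve_letters`, `navierStokesBreakdownR3_of_valve_letters`: the design-fixing probe —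
  a valve on the letters IS the quiet bounded door.

References: T. Tao, J. Amer. Math. Soc. 29 (2016) 601–674, §1.3 [cite: Tao2016AveragedNS, §1.3];
C. L. Fefferman, Clay problem description, (C) [cite: FeffermanClay2006, (C)]. 0 sorry; axioms ⊆
{propext, Classical.choice, Quot.sound}.
-/

noncomputable section

namespace Summit.NavierStokesRegularity.FluidComputer.TriggeredTransfer

open Set MeasureTheory Function
open scoped ENNReal ContDiff NNReal
open Literature.Analysis.FluidPDE
open Literature.Analysis.FluidPDE.FluidComputer (E3 Vel)

namespace TriggerScheme

variable {𝒮 : TriggerScheme}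

/-! ## The zero trigger and the Re-uniform clock -/

/-- The zero force is an admissible trigger of every amplitude `ε ≥ 0` (all clauses are trivial;
`‖Dⁱ 0‖ = 0 ≤ ε A_i`). [folklore] -/
theorem isTrigger_zero {ε : ℝ} (hε : 0 ≤ ε) (δ T : ℝ) : 𝒮.IsTrigger ε δ T (fun _ => (0 : Vel)) where
  smooth := by
    have : uncurry (fun _ : ℝ => (0 : Vel)) = fun _ => 0 := by
      funext z; rfl
    rw [this]; exact contDiff_const
  off_early _ _ := rfl
  off_late _ _ := rfl
  off_far _ _ _ := rfl
  small i z := by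
    have : uncurry (fun _ : ℝ => (0 : Vel)) = fun _ => 0 := by
      funext z; rfl
    rw [this, iteratedFDeriv_fun_zero, Pi.zero_apply, norm_zero]
    exact mul_nonneg hε (𝒮.A_nonneg i)

/-- The Re-uniform law fits in the door's law on its own: `C_τ / 2 / U ≤ C_τ (1 + |log ε|)^q / U`
(`U > 0`). [folklore] -/
theorem valveClock_le {U T₂ : ℝ} (hU : 0 < U) (ε : ℝ) (hT₂ : T₂ ≤ 𝒮.Cτ / 2 / U) :
    T₂ ≤ 𝒮.Cτ * (1 + |Real.log ε|) ^ 𝒮.q / U := by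
  have h := 𝒮.clock_of_pieces (ε := ε) (T₁ := 0) hU (by
    have : 0 ≤ 𝒮.Cτ / 2 * (1 + |Real.log ε|) ^ 𝒮.q / U :=
      div_nonneg (mul_nonneg (by linarith [𝒮.Cτ_pos]) (le_trans zero_le_one (𝒮.one_le_logFactor ε)))
        hU.le
    exact this) hT₂
  simpa using h

/-! ## Junk map / BC2 probes: the pieces are jointly, not severally, load-bearing -/

/-- The amplifier gets EASIER as the kicked alphabet grows (more admissible targets). [folklore] -/
theorem Amplifies.mono {𝒦 𝒦' : 𝒮.KickAlphabet} {ν : ℝ} (h : 𝒮.Amplifies 𝒦 ν)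
    (hK : ∀ U, 𝒦.K U ⊆ 𝒦'.K U) : 𝒮.Amplifies 𝒦' ν := by
  intro U hU w hw ε hε hε1 hadm
  obtain ⟨T₁, δ, g, u, p, hδ, h2δ, hT₁, htrig, hsol, hu0, hE, hM, hk⟩ := h U hU w hw ε hε hε1 hadm
  exact ⟨T₁, δ, g, u, p, hδ, h2δ, hT₁, htrig, hsol, hu0, hE, hM, hK U hk⟩

/-- The valve gets HARDER as the kicked alphabet grows (more sources to hand over from). [folklore] -/
theorem Valve.anti {𝒦 𝒦' : 𝒮.KickAlphabet} {ν : ℝ} (h : 𝒮.Valve 𝒦' ν)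
    (hK : ∀ U, 𝒦.K U ⊆ 𝒦'.K U) : 𝒮.Valve 𝒦 ν :=
  fun U hU v hv => h U hU v (hK U hv)

/-- **The empty kicked alphabet** (junk probe): no state is kicked. [folklore] -/
def KickAlphabet.empty (𝒮 : TriggerScheme) : 𝒮.KickAlphabet where
  K := fun _ => ∅
  clay := fun _ _ v hv => (Set.notMem_empty v hv).elim
  floor := fun _ _ v hv => (Set.notMem_empty v hv).elim

/-- BC2 probe, valve side: with NO kicked states the valve holds VACUOUSLY at every viscosity — so
`Valve` alone carries no content and cannot give (C). [folklore] -/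
theorem valve_empty (𝒮 : TriggerScheme) (ν : ℝ) : 𝒮.Valve (KickAlphabet.empty 𝒮) ν :=
  fun _ _ v hv => (Set.notMem_empty v hv).elim

/-- BC2 probe, amplifier side: with NO kicked states the amplifier is FALSE at every viscosity (the
ignition level is inhabited and `ε = 1` is always admissible, but no run can end in `∅`) — so the
vacuous valve of `valve_empty` never meets an amplifier: the two pieces constrain each other through
the shared alphabet. [folklore] -/
theorem not_amplifies_empty (𝒮 : TriggerScheme) (ν : ℝ) : ¬ 𝒮.Amplifies (KickAlphabet.empty 𝒮) ν := by
  intro h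
  obtain ⟨U₀, hU₀, w₀, hw₀⟩ := 𝒮.seed
  have hadm : ν * |Real.log 1| ≤ 𝒮.a * U₀ := by
    rw [Real.log_one, abs_zero, mul_zero]
    exact mul_nonneg 𝒮.a_pos.le (𝒮.UStar_pos.le.trans hU₀)
  obtain ⟨T₁, -, -, u, -, -, -, -, -, -, -, -, -, hk⟩ := h U₀ hU₀ w₀ hw₀ 1 one_pos le_rfl hadm
  exact Set.notMem_empty (u T₁) hk

/-- **A valve from a kicked LETTER is an untriggered bounded step.** If the member `w ∈ F U` is itself
a kicked state, the valve's unforced hand-over run from `w` is a `StepB ν U ε w` for EVERY `ε ≥ 0`,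
with the ZERO trigger (`isTrigger_zero`) and the Re-uniform clock (`valveClock_le`); no gluing, no
uniqueness, any `ν`. [cite: Tao2016AveragedNS, §1.3] -/
theorem stepB_of_valve_of_mem {𝒦 : 𝒮.KickAlphabet} {ν U ε : ℝ} {w : Vel} (hV : 𝒮.Valve 𝒦 ν)
    (hU : 𝒮.UStar ≤ U) (hw : w ∈ 𝒦.K U) (hε : 0 ≤ ε) : 𝒮.StepB ν U ε w := by
  obtain ⟨T₂, δ, u, p, hδ, h2δ, hT₂, hsol, hu0, ⟨C, hC, hb⟩, ⟨M, hm⟩, U', w', x₀, hgrow, hw', hx₀,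
    hhand⟩ := hV U hU w hw
  have hU0 : 0 < U := 𝒮.UStar_pos.trans_le hU
  exact ⟨{ T := T₂, δ := δ, g := fun _ => 0, u := u, p := p, U' := U', w' := w', x₀ := x₀
           δ_pos := hδ, two_δ_lt := h2δ, T_le := 𝒮.valveClock_le hU0 ε hT₂
           trigger := 𝒮.isTrigger_zero hε δ T₂, classical := hsol, initial := hu0
           energy := ⟨C, hC, hb⟩, growth_le := hgrow, mem := hw', norm_x₀_le := hx₀
           handover := hhand }, M, hm⟩

/-- **Valve-only door** (the QUIET schedule; BC2 probe of the delta between the shapes): if every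
letter of the scheme is a kicked state (`F U ⊆ K U` for `U ≥ U⋆`), the valve ALONE gives the bounded
door `TransfersB ν` — at ANY viscosity and with zero triggers. The amplifier is needed exactly because
the members of `F U` are not kicked; a register whose schedules are quiet (unforced after preparation)
is valve-only by construction. [cite: Tao2016AveragedNS, §1.3] -/
theorem transfersB_of_valve_of_letters_kicked {𝒦 : 𝒮.KickAlphabet} {ν : ℝ} (hV : 𝒮.Valve 𝒦 ν)
    (hFK : ∀ U, 𝒮.UStar ≤ U → 𝒮.F U ⊆ 𝒦.K U) : 𝒮.TransfersB ν :=
  fun U hU _ hw _ hε _ _ => 𝒮.stepB_of_valve_of_mem hV hU (hFK U hU hw) hε.le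

/-- The valve-only door closes (C) as well (`ν > 0`), zero named facts. [cite: FeffermanClay2006, (C)] -/
theorem navierStokesBreakdownR3_of_valve_of_letters_kicked {𝒦 : 𝒮.KickAlphabet} {ν : ℝ}
    (hν : 0 < ν) (hV : 𝒮.Valve 𝒦 ν) (hFK : ∀ U, 𝒮.UStar ≤ U → 𝒮.F U ⊆ 𝒦.K U) :
    Summit.NavierStokesRegularity.NavierStokesRegularity.NavierStokesBreakdownR3 :=
  navierStokesBreakdownR3_of_exists_transfersB_at hν ⟨𝒮, transfersB_of_valve_of_letters_kicked hV hFK⟩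

/-- **The letters as kicked alphabet** (the design-fixing probe «(ii)» of the package's notes, for
free): `K U := F U` is a kicked alphabet of ANY scheme — the Clay clauses and the speed floor are the
scheme's own axioms. With it, `Valve` reads «the UNFORCED flow takes every letter to a zoomed letter one
level up within `C_τ/2/U`» (a quiet door) and `Amplifies` reads «under every admissible seed the FORCED
flow returns to SOME letter of the same level within the logarithmic time» (a reset gate). [folklore] -/
def KickAlphabet.letters (𝒮 : TriggerScheme) : 𝒮.KickAlphabet where
  K := 𝒮.F
  clay := 𝒮.clay
  floor := 𝒮.floor

/-- The kicked states of `KickAlphabet.letters` are the letters. [folklore] -/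
@[simp] theorem KickAlphabet.letters_K (𝒮 : TriggerScheme) (U : ℝ) :
    (KickAlphabet.letters 𝒮).K U = 𝒮.F U := rfl

/-- **A valve on the letters IS the (quiet) bounded door**: `Valve 𝒮 letters ν → TransfersB ν`, any
`ν`, zero triggers, no amplifier. [cite: Tao2016AveragedNS, §1.3] -/
theorem transfersB_of_valve_letters {ν : ℝ} (hV : 𝒮.Valve (KickAlphabet.letters 𝒮) ν) :
    𝒮.TransfersB ν :=
  transfersB_of_valve_of_letters_kicked hV fun _ _ => subset_rfl

/-- … and therefore closes (C) for `ν > 0`, zero named facts. [cite: FeffermanClay2006, (C)] -/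
theorem navierStokesBreakdownR3_of_valve_letters {ν : ℝ} (hν : 0 < ν)
    (hV : 𝒮.Valve (KickAlphabet.letters 𝒮) ν) :
    Summit.NavierStokesRegularity.NavierStokesRegularity.NavierStokesBreakdownR3 :=
  navierStokesBreakdownR3_of_exists_transfersB_at hν ⟨𝒮, transfersB_of_valve_letters hV⟩

end TriggerScheme

end Summit.NavierStokesRegularity.FluidComputer.TriggeredTransfer

end
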